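import Summits.BirchSwinnertonDyer.BirchSwinnertonDyer.Theorems.SignedLowerHalvesSmallImageLowerHalfBothSignsRttCharRoad
import Summits.BirchSwinnertonDyer.BirchSwinnertonDyer.Theorems.SignedLowerHalvesSmallImageLowerHalfBothSignsRttCharRoadE1Algebra
import HarnessLib

/-!
# Route `SignedLowerHalves`, crux L `SmallImageLowerHalfBothSigns` (stmt-BirchSwinnertonDyer-23599), line `rtt_w3` v9 — E1 ⟸ COUNT:
# conjunct E1 of the registered stub `stub_charRoad_ns` (residual signed Selmer transfer `W ↔ ψ_𝔭`, = hypothesis `hE1` of the landed glue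
# `psbTheta_of_charRoad`, p760663) REDUCED to the RESIDUAL COUNT `#Sel^{ε,S₀K}_𝒪(K_∞, (F/𝒪)(θ))[p] ≤ p^{[F:ℚ_p]·(λ(X^ε_W) + Σ_{S₀} δ_W)}` by the
# landed `Λ`-algebra brick `SignedTransportDualDataSat.finite_torsion_lambda_le_of_card_pTorsion_le` (`Theorems/…RttCharRoadE1Algebra.lean`).

LEAD `cruxlead-stmt-BirchSwinnertonDyer-23599` g6; helper `--supports stmt-BirchSwinnertonDyer-23599`; THEOREMS ONLY, no `sorry`; closes nothing;
BSD / crux L / E1 / COUNT are NOT proved by this file.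

WHAT. `charRoad_E1_of_count (hcount : COUNT) : E1` with E1 VERBATIM (= `hE1` of `SmallImageRttCharRoad.psbTheta_of_charRoad`) and COUNT = the same
binder prefix (class, guards, `ε`, the `K/ψ/𝔪/e` block, the small-image datum `Φ, k, e₀`, the partner block, `κ, γ`, `S₀`, the character data
`S, θ, γK, j` with `0 < [F:ℚ_p]`, the pinning of `θ` to `ψ`, `γK` a generator of `K·ℚ_∞/K`, `j` equivariant above `p` with `𝒪`-span everything —
WITHOUT the dual datum `Dψ`) followed by: for every signed dual datum `D` of `W` over `ℚ_∞` at sign `ε`, f.g. torsion with `μ = 0`,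
«the `p`-torsion of `Sel^{ε,S₀K}_𝒪(K_∞, (F/𝒪)(θ))` (saturated transport carrier D1-T′) is finite with at most `p^{[F:ℚ_p]·(λ(D.X) + Σ_{v∈S₀} δ_W^{(v)})}`
elements». COUNT is the honest research residue of E1: a RESIDUAL statement (Shapiro transport `H¹(ℚ_∞, W[p] ⊗ k') ≅ H¹(K_∞, k'(θ̄))` with
matching local conditions — B2 p754471 / B3 p754562 / B3′ p757129 landed —, B. D. Kim's control `Sel^ε(W[p]) = Sel^ε(W[p^∞])[p]`, no finite
`Λ`-submodule in `X^{ε,S₀}_W` (B. D. Kim 2013 / Kitajima–Otsuki), Greenberg–Vatsal `λ(X^{S₀}) = λ(X) + Σδ`, and `dim_{𝔽_p} Sel_θ[p] ≤ [F:ℚ_p]·dim_{k'} Sel_θ[π]`).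
Proof of the glue: instantiate COUNT, then the brick with `GreenbergSelmer.exists_pow_smul_cofree_eq_zero` / `isOpen_stabilizer_cofree` and `hγK`.

References: [GreenbergLNM1716] §1 p. 60, §4 p. 98; [GreenbergVatsal2000] §2 Prop. (2.4), (2.8); [BDKim2009] Cor. 2.13; [Kobayashi2003] Def. 1.1;
[EmertonPollackWeston2006] Thm. 3.1.1.
-/

set_option autoImplicit false
-- D-0017: single-problem summit, the namespace repeats the problem name by design.
set_option linter.dupNamespace false
noncomputable section

open scoped Classical MatrixGroups ModularForm BigOperators NumberField

open CongruenceSubgroup WeierstrassCurve Field Polynomial NumberField IsDedekindDomain Matrix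
  Literature.NumberTheory.EllipticCurves Literature.NumberTheory.EllipticCurves.ModularForms
  Literature.NumberTheory.EllipticCurves.Rank1Residual
  Literature.NumberTheory.EllipticCurves.Kobayashi2003
  Literature.NumberTheory.EllipticCurves.GreenbergVatsal2000 ZpExtension
  Literature.NumberTheory.IwasawaTheory Rat.HeightOneSpectrum
  Literature.NumberTheory.GaloisRepresentations Literature.NumberTheory.LFunctions
  Literature.NumberTheory.GaloisRepresentations.HeckeCharacter Literature.NumberTheory.Automorphic
  Summit.BirchSwinnertonDyer.Rank1Residual Summit.BirchSwinnertonDyer.Rank1Residual.Supersingular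
  Summit.BirchSwinnertonDyer.Rank1Residual.X1.MuLambda
  Summit.BirchSwinnertonDyer.Rank1Residual.X2.EulerFactorInvariants
  Summit.BirchSwinnertonDyer.BirchSwinnertonDyer.Theorems.SmallImageLambdaLowerThreeNsThetaTransport
  Summit.BirchSwinnertonDyer.BirchSwinnertonDyer.Theorems.HeckeThetaPartner
  Summit.BirchSwinnertonDyer.BirchSwinnertonDyer.Theorems

namespace Summit.BirchSwinnertonDyer.BirchSwinnertonDyer.Theorems.SmallImageRttCharRoad

/-- ★ **E1 ⟸ COUNT.** Hypothesis `hcount` = COUNT (the residual count, see the module docstring); conclusion = conjunct E1 of `stub_charRoad_ns`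
VERBATIM (= `hE1` of `psbTheta_of_charRoad`). Proof: for the given `Dψ`, `D`, instantiate COUNT and apply the `Λ`-algebra brick
`SignedTransportDualDataSat.finite_torsion_lambda_le_of_card_pTorsion_le` (`M = Cofree θ F` is `p`-primary with open stabilisers; `γK` generates).
CONDITIONAL reduction; closes nothing; BSD / crux L / E1 not proved. [cite: GreenbergLNM1716, §1 p. 60, §4 p. 98] [cite: GreenbergVatsal2000, §2 Prop. (2.8)]
[cite: EmertonPollackWeston2006, Thm. 3.1.1] -/
theorem charRoad_E1_of_count
    (hcount : ∀ (W : WeierstrassCurve ℚ) [W.IsElliptic] [W.IsGloballyMinimal] (p : ℕ) [Fact p.Prime],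
            ∀ (hp : p ≠ 2), ClassX7 W p → ¬ W.HasCM → W.frobeniusTrace p = 0 → ¬ Surj W p →
            ¬ (∃ (A : WeierstrassCurve ℚ) (_ : A.IsElliptic) (_ : A.IsGloballyMinimal),
              A.HasCM ∧ GoodSS A p ∧ A.frobeniusTrace p = 0 ∧
                ∃ e : geomTorsion W (p : ℤ) ≃+ geomTorsion A (p : ℤ),
                  ∀ (σ : absoluteGaloisGroup ℚ) (P : geomTorsion W (p : ℤ)), e (σ • P) = σ • e P) →
            ¬ (∃ (A : WeierstrassCurve ℚ) (_ : A.IsElliptic) (_ : A.IsGloballyMinimal) (t : ℚ),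
              A.HasGoodReductionAtPrime p ∧ A.frobeniusTrace p = 0 ∧
                (∃ e : geomTorsion W (p : ℤ) ≃+ geomTorsion A (p : ℤ),
                  ∀ (σ : absoluteGaloisGroup ℚ) (P : geomTorsion W (p : ℤ)), e (σ • P) = σ • e P) ∧
                A.entireLFunction 1 / (A.realPeriodRat : ℂ) = ((t : ℚ) : ℂ) ∧ t ≠ 0 ∧ padicValRat p t = 0) →
            ∀ (ε : ℤˣ) (K : Type) [Field K] [NumberField K] (σK : K →+* ℂ) (𝔪 : Ideal (𝓞 K))
              (ψ : HeightOneSpectrum (𝓞 K) → ℂ) (e : PadicAlgCl p ≃+* ℂ),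
              ∀ (hK2 : Module.finrank ℚ K = 2), IsTotallyComplex K → 𝔪 ≠ ⊥ →
              (∀ I : Ideal (𝓞 K), Ideal.absNorm I ≠ p) → ¬ p ∣ (NumberField.discr K).natAbs * Ideal.absNorm 𝔪 →
              (∀ (ℓ : ℕ) [Fact ℓ.Prime], ℓ ∣ (NumberField.discr K).natAbs * Ideal.absNorm 𝔪 → ¬ W.HasGoodReductionAtPrime ℓ) →
              IsGrossencharakter 𝔪 (embType σK) (embTypeConj σK) ψ →
              (∀ n : ℕ, Odd n → n.Coprime ((NumberField.discr K).natAbs * Ideal.absNorm 𝔪) →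
                idealPow K ψ (Ideal.span {(n : 𝓞 K)}) = (jacobiSym (NumberField.discr K) n : ℂ) * (n : ℂ) ^ (2 - 1)) →
              (∀ (ℓ : ℕ) [Fact ℓ.Prime], ℓ ≠ p → W.HasGoodReductionAtPrime ℓ →
                ‖e.symm (∑ᶠ (w : HeightOneSpectrum (𝓞 K)) (_ : Ideal.absNorm w.asIdeal = ℓ), ψ w) -
                  (W.frobeniusTrace ℓ : PadicAlgCl p)‖ < 1) →
              (∃ v : HeightOneSpectrum (𝓞 K), v.asIdeal = Ideal.span {(p : 𝓞 K)} ∧ Nat.card (𝓞 K ⧸ v.asIdeal) = p ^ 2) →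
              ¬ (p : ℤ) ∣ NumberField.discr K →
            ∀ (Φ : Multiplicative (AddAut (geomTorsion W p)) ≃* GL (Fin 2) (ZMod p))
              (k : Subalgebra (ZMod p) (Matrix (Fin 2) (Fin 2) (ZMod p))) (e₀ : geomTorsion W p ≃+ (Fin 2 → ZMod p)),
              (∀ (g : Multiplicative (AddAut (geomTorsion W p))) (x : geomTorsion W p),
                e₀ (Multiplicative.toAdd g x) = ((Φ g : GL (Fin 2) (ZMod p)) : Matrix (Fin 2) (Fin 2) (ZMod p)) *ᵥ e₀ x) →
              IsField k → Module.finrank (ZMod p) k = 2 →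
              (letI : Module (ZMod p) (geomTorsion W p) := AddSubgroup.torsionBy.zmodModule
                ∀ g : Multiplicative (AddAut (geomTorsion W p)),
                  Matrix.trace ((Φ g : GL (Fin 2) (ZMod p)) : Matrix (Fin 2) (Fin 2) (ZMod p)) =
                    LinearMap.trace (ZMod p) (geomTorsion W p) ((Multiplicative.toAdd g).toAddMonoidHom.toZModLinearMap p)) →
              (galoisRepTorsion W p).range.map Φ.toMonoidHom ≤
                Subgroup.normalizer (Serre1972.unitGroup k : Set (GL (Fin 2) (ZMod p))) →
              ((Serre1972.unitGroup k).comap Φ.toMonoidHom).comap (galoisRepTorsion W p) ≤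
                (absGaloisRestrict ℚ K).toMonoidHom.range →
              (∀ τ : absoluteGaloisGroup K, Φ (galoisRepTorsion W p (absGaloisRestrict ℚ K τ)) ∈ Serre1972.unitGroup k) →
            ∀ (M : ℕ) [NeZero M] (g : CuspForm (Gamma0 M) 2) (ι : coeffField g →+* PadicAlgCl p) (Ω : ℂ),
              ¬ p ∣ M → IsNewform0 g → Literature.NumberTheory.Automorphic.IsCMForm (liftToGamma1 M 2 g) →
              cuspCoeff g p = 0 → IsCohomologicalPlusPeriod g ι Ω →
              (∀ ℓ : ℕ, ℓ.Prime → ¬ ℓ ∣ p * M * W.conductorNorm ℤ →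
                ‖embCoeff g ι ℓ - (W.frobeniusTrace ℓ : PadicAlgCl p)‖ < 1) →
              (∀ ℓ : ℕ, ℓ.Prime → ¬ ℓ ∣ (NumberField.discr K).natAbs * Ideal.absNorm 𝔪 →
                embCoeff g ι ℓ = e.symm (∑ᶠ (w : HeightOneSpectrum (𝓞 K)) (_ : Ideal.absNorm w.asIdeal = ℓ), ψ w)) →
              ∀ (κ : ZpExtension ℚ p) (γ : absoluteGaloisGroup ℚ),
                κ.IsCyclotomic → κ.IsTopGenerator γ → IsCyclotomicVariable p γ →
              ∀ (S₀ : Finset (HeightOneSpectrum (𝓞 ℚ))), (∀ v ∈ S₀, ((p : ℕ) : 𝓞 ℚ) ∉ v.asIdeal) →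
                (∀ v : HeightOneSpectrum (𝓞 ℚ), ¬ W.HasGoodReductionAt v → v ∈ S₀) →
                (∀ v : HeightOneSpectrum (𝓞 ℚ), natGenerator v ∣ M → v ∈ S₀) →
              ∀ (S : Set (PadicAlgCl p)) (θ : FramedGaloisRep K (padicCoeffIntegers S) 1) (γK : absoluteGaloisGroup K)
                (j : (W.baseChange K).geomPrimaryTorsion p →+ (GreenbergSelmer.Cofree θ (padicCoeffField S))),
                0 < Module.finrank ℚ_[p] (padicCoeffField S) →
                (∀ w : HeightOneSpectrum (𝓞 K), (p : 𝓞 K) ∉ w.asIdeal → ¬ 𝔪 ≤ w.asIdeal →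
                  θ.IsUnramifiedAt w ∧ ∃ P : Polynomial (padicCoeffIntegers S),
                    P.map (padicCoeffIntegers S).subtype = X - C (e.symm (ψ w)) ∧ θ.HasFrobCharpolyAt w P) →
                (κ.restrictOfFinrankEqTwo hp K hK2).IsTopGenerator γK →
                (∀ v : HeightOneSpectrum (𝓞 K), (p : 𝓞 K) ∈ v.asIdeal →
                  ∀ (δ : absoluteGaloisGroup (v.adicCompletion K)) (t : (W.baseChange K).geomPrimaryTorsion p),
                    j (resGalOfEmb (closureEmb (K := K) (v.adicCompletion K)) δ • t) =
                      resGalOfEmb (closureEmb (K := K) (v.adicCompletion K)) δ • j t) →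
                Submodule.span (padicCoeffIntegers S) (Set.range j) = ⊤ →
              ∀ (D : SignedSelmerDualData W κ γ ε) [Module.Finite (IwasawaAlgebra p) D.X],
                Module.IsTorsion (IwasawaAlgebra p) D.X → D.mu = 0 →
                {s : SmallImageCharSignedSelmer.signedTransportSelmerInftySat (κ.restrictOfFinrankEqTwo hp K hK2)
                    (GreenbergSelmer.Cofree θ (padicCoeffField S)) (padicCoeffIntegers S) (W.baseChange K) j
                    {w : HeightOneSpectrum (𝓞 K) | ∃ v ∈ S₀, ((natGenerator v : ℕ) : 𝓞 K) ∈ w.asIdeal} ε | p • s = 0}.Finite ∧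
                  Nat.card {s : SmallImageCharSignedSelmer.signedTransportSelmerInftySat (κ.restrictOfFinrankEqTwo hp K hK2)
                    (GreenbergSelmer.Cofree θ (padicCoeffField S)) (padicCoeffIntegers S) (W.baseChange K) j
                    {w : HeightOneSpectrum (𝓞 K) | ∃ v ∈ S₀, ((natGenerator v : ℕ) : 𝓞 K) ∈ w.asIdeal} ε | p • s = 0} ≤
                    p ^ (Module.finrank ℚ_[p] (padicCoeffField S) * (lambdaInvariant p D.X + ∑ v ∈ S₀, delta W p v))) :
    ∀ (W : WeierstrassCurve ℚ) [W.IsElliptic] [W.IsGloballyMinimal] (p : ℕ) [Fact p.Prime],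
          ∀ (hp : p ≠ 2), ClassX7 W p → ¬ W.HasCM → W.frobeniusTrace p = 0 → ¬ Surj W p →
          ¬ (∃ (A : WeierstrassCurve ℚ) (_ : A.IsElliptic) (_ : A.IsGloballyMinimal),
            A.HasCM ∧ GoodSS A p ∧ A.frobeniusTrace p = 0 ∧
              ∃ e : geomTorsion W (p : ℤ) ≃+ geomTorsion A (p : ℤ),
                ∀ (σ : absoluteGaloisGroup ℚ) (P : geomTorsion W (p : ℤ)), e (σ • P) = σ • e P) →
          ¬ (∃ (A : WeierstrassCurve ℚ) (_ : A.IsElliptic) (_ : A.IsGloballyMinimal) (t : ℚ),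
            A.HasGoodReductionAtPrime p ∧ A.frobeniusTrace p = 0 ∧
              (∃ e : geomTorsion W (p : ℤ) ≃+ geomTorsion A (p : ℤ),
                ∀ (σ : absoluteGaloisGroup ℚ) (P : geomTorsion W (p : ℤ)), e (σ • P) = σ • e P) ∧
              A.entireLFunction 1 / (A.realPeriodRat : ℂ) = ((t : ℚ) : ℂ) ∧ t ≠ 0 ∧ padicValRat p t = 0) →
          ∀ (ε : ℤˣ) (K : Type) [Field K] [NumberField K] (σK : K →+* ℂ) (𝔪 : Ideal (𝓞 K))
            (ψ : HeightOneSpectrum (𝓞 K) → ℂ) (e : PadicAlgCl p ≃+* ℂ),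
            ∀ (hK2 : Module.finrank ℚ K = 2), IsTotallyComplex K → 𝔪 ≠ ⊥ →
            (∀ I : Ideal (𝓞 K), Ideal.absNorm I ≠ p) → ¬ p ∣ (NumberField.discr K).natAbs * Ideal.absNorm 𝔪 →
            (∀ (ℓ : ℕ) [Fact ℓ.Prime], ℓ ∣ (NumberField.discr K).natAbs * Ideal.absNorm 𝔪 → ¬ W.HasGoodReductionAtPrime ℓ) →
            IsGrossencharakter 𝔪 (embType σK) (embTypeConj σK) ψ →
            (∀ n : ℕ, Odd n → n.Coprime ((NumberField.discr K).natAbs * Ideal.absNorm 𝔪) →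
              idealPow K ψ (Ideal.span {(n : 𝓞 K)}) = (jacobiSym (NumberField.discr K) n : ℂ) * (n : ℂ) ^ (2 - 1)) →
            (∀ (ℓ : ℕ) [Fact ℓ.Prime], ℓ ≠ p → W.HasGoodReductionAtPrime ℓ →
              ‖e.symm (∑ᶠ (w : HeightOneSpectrum (𝓞 K)) (_ : Ideal.absNorm w.asIdeal = ℓ), ψ w) -
                (W.frobeniusTrace ℓ : PadicAlgCl p)‖ < 1) →
            (∃ v : HeightOneSpectrum (𝓞 K), v.asIdeal = Ideal.span {(p : 𝓞 K)} ∧ Nat.card (𝓞 K ⧸ v.asIdeal) = p ^ 2) →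
            ¬ (p : ℤ) ∣ NumberField.discr K →
          ∀ (Φ : Multiplicative (AddAut (geomTorsion W p)) ≃* GL (Fin 2) (ZMod p))
            (k : Subalgebra (ZMod p) (Matrix (Fin 2) (Fin 2) (ZMod p))) (e₀ : geomTorsion W p ≃+ (Fin 2 → ZMod p)),
            (∀ (g : Multiplicative (AddAut (geomTorsion W p))) (x : geomTorsion W p),
              e₀ (Multiplicative.toAdd g x) = ((Φ g : GL (Fin 2) (ZMod p)) : Matrix (Fin 2) (Fin 2) (ZMod p)) *ᵥ e₀ x) →
            IsField k → Module.finrank (ZMod p) k = 2 →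
            (letI : Module (ZMod p) (geomTorsion W p) := AddSubgroup.torsionBy.zmodModule
              ∀ g : Multiplicative (AddAut (geomTorsion W p)),
                Matrix.trace ((Φ g : GL (Fin 2) (ZMod p)) : Matrix (Fin 2) (Fin 2) (ZMod p)) =
                  LinearMap.trace (ZMod p) (geomTorsion W p) ((Multiplicative.toAdd g).toAddMonoidHom.toZModLinearMap p)) →
            (galoisRepTorsion W p).range.map Φ.toMonoidHom ≤
              Subgroup.normalizer (Serre1972.unitGroup k : Set (GL (Fin 2) (ZMod p))) →
            ((Serre1972.unitGroup k).comap Φ.toMonoidHom).comap (galoisRepTorsion W p) ≤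
              (absGaloisRestrict ℚ K).toMonoidHom.range →
            (∀ τ : absoluteGaloisGroup K, Φ (galoisRepTorsion W p (absGaloisRestrict ℚ K τ)) ∈ Serre1972.unitGroup k) →
          ∀ (M : ℕ) [NeZero M] (g : CuspForm (Gamma0 M) 2) (ι : coeffField g →+* PadicAlgCl p) (Ω : ℂ),
            ¬ p ∣ M → IsNewform0 g → Literature.NumberTheory.Automorphic.IsCMForm (liftToGamma1 M 2 g) →
            cuspCoeff g p = 0 → IsCohomologicalPlusPeriod g ι Ω →
            (∀ ℓ : ℕ, ℓ.Prime → ¬ ℓ ∣ p * M * W.conductorNorm ℤ →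
              ‖embCoeff g ι ℓ - (W.frobeniusTrace ℓ : PadicAlgCl p)‖ < 1) →
            (∀ ℓ : ℕ, ℓ.Prime → ¬ ℓ ∣ (NumberField.discr K).natAbs * Ideal.absNorm 𝔪 →
              embCoeff g ι ℓ = e.symm (∑ᶠ (w : HeightOneSpectrum (𝓞 K)) (_ : Ideal.absNorm w.asIdeal = ℓ), ψ w)) →
            ∀ (κ : ZpExtension ℚ p) (γ : absoluteGaloisGroup ℚ),
              κ.IsCyclotomic → κ.IsTopGenerator γ → IsCyclotomicVariable p γ →
            ∀ (S₀ : Finset (HeightOneSpectrum (𝓞 ℚ))), (∀ v ∈ S₀, ((p : ℕ) : 𝓞 ℚ) ∉ v.asIdeal) →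
              (∀ v : HeightOneSpectrum (𝓞 ℚ), ¬ W.HasGoodReductionAt v → v ∈ S₀) →
              (∀ v : HeightOneSpectrum (𝓞 ℚ), natGenerator v ∣ M → v ∈ S₀) →
            ∀ (S : Set (PadicAlgCl p)) (θ : FramedGaloisRep K (padicCoeffIntegers S) 1) (γK : absoluteGaloisGroup K)
              (j : (W.baseChange K).geomPrimaryTorsion p →+ (GreenbergSelmer.Cofree θ (padicCoeffField S))),
              0 < Module.finrank ℚ_[p] (padicCoeffField S) →
              (∀ w : HeightOneSpectrum (𝓞 K), (p : 𝓞 K) ∉ w.asIdeal → ¬ 𝔪 ≤ w.asIdeal →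
                θ.IsUnramifiedAt w ∧ ∃ P : Polynomial (padicCoeffIntegers S),
                  P.map (padicCoeffIntegers S).subtype = X - C (e.symm (ψ w)) ∧ θ.HasFrobCharpolyAt w P) →
              (κ.restrictOfFinrankEqTwo hp K hK2).IsTopGenerator γK →
              (∀ v : HeightOneSpectrum (𝓞 K), (p : 𝓞 K) ∈ v.asIdeal →
                ∀ (δ : absoluteGaloisGroup (v.adicCompletion K)) (t : (W.baseChange K).geomPrimaryTorsion p),
                  j (resGalOfEmb (closureEmb (K := K) (v.adicCompletion K)) δ • t) =
                    resGalOfEmb (closureEmb (K := K) (v.adicCompletion K)) δ • j t) →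
              Submodule.span (padicCoeffIntegers S) (Set.range j) = ⊤ →
            ∀ (Dψ : SmallImageCharSignedSelmer.SignedTransportDualDataSat (κ.restrictOfFinrankEqTwo hp K hK2) γK
                (GreenbergSelmer.Cofree θ (padicCoeffField S)) (padicCoeffIntegers S) (W.baseChange K) j
                {w : HeightOneSpectrum (𝓞 K) | ∃ v ∈ S₀, ((natGenerator v : ℕ) : 𝓞 K) ∈ w.asIdeal} ε),
            ∀ (D : SignedSelmerDualData W κ γ ε) [Module.Finite (IwasawaAlgebra p) D.X],
              Module.IsTorsion (IwasawaAlgebra p) D.X → D.mu = 0 →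
              Module.Finite (IwasawaAlgebra p) Dψ.X ∧ Module.IsTorsion (IwasawaAlgebra p) Dψ.X ∧
                lambdaInvariant p Dψ.X ≤ Module.finrank ℚ_[p] (padicCoeffField S) * (lambdaInvariant p D.X + ∑ v ∈ S₀, delta W p v) := by
  intro W _ _ p _ hp hX hcm hap hs hT1 hTu ε K _ _ σK 𝔪 ψ e hK2 htc h𝔪 hnop hpD hbad hψG hneb htrace hv hpd
      Φ k e₀ he₀ hk h2 htr hGN hUle hKU M _ g ι Ω hpM hnew hcmf hapg hΩ hcong hcoeff κ γ hκ hγ hγT S₀ hS₀p hS₀bad hS₀M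
      S θ γK j hfin hθ hγK hjeq hjspan Dψ D _ htor hμ
  obtain ⟨hfinSel, hcard⟩ :=
    hcount W p hp hX hcm hap hs hT1 hTu ε K σK 𝔪 ψ e hK2 htc h𝔪 hnop hpD hbad hψG hneb htrace hv hpd Φ k e₀ he₀ hk h2 htr hGN hUle hKU M g ι Ω hpM hnew hcmf hapg hΩ hcong hcoeff κ γ hκ hγ hγT S₀ hS₀p hS₀bad hS₀M S θ γK j hfin hθ hγK hjeq hjspan D htor hμ
  exact Dψ.finite_torsion_lambda_le_of_card_pTorsion_le (GreenbergSelmer.exists_pow_smul_cofree_eq_zero S θ)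
    (GreenbergSelmer.isOpen_stabilizer_cofree S θ) hγK hfinSel hcard

end Summit.BirchSwinnertonDyer.BirchSwinnertonDyer.Theorems.SmallImageRttCharRoad

end
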